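import Mathlib
import Literature.Probability.Percolation.PercolationProofs
import Literature.Probability.Percolation.PercolationEvents

/-!
# `SliceFillingUpperBound`, part 1: the covering projection and edge windows of small boxes
(route PercTorusSliceFilling, item stmt-CriticalPhenomena-5416, helper file 1/3)

Support item `SliceFillingUpperBound` of the route `PercTorusSliceFilling` asks for
`θ_{ℤ³}(p) ≤ P_{T_n,p}(C(x) is slice-filling)` for bond percolation on the discrete torus
`T_n = (ℤ/nℤ)³`, `n ≥ 3`. The proof (finished in `PercTorusSliceFillingSliceFillingUpperBound.lean`)
is a STATIC box-hull coupling: if the torus cluster of `x` misses a slice in every direction, the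
periodic lift of the configuration has a finite cluster at the origin whose box-hull `b` has at most
`n - 1` points per side, and on the edge window of such a box the covering projection is injective,
so that each hull event has the same probability upstairs (`ℤ^d`) and downstairs (`T_n`).

This file contains the deterministic combinatorics, for every dimension `d`; no auxiliary
definition is introduced (the projection `π_x : ℤ^d → (ℤ/nℤ)^d`, `z ↦ x + (z mod n)`, is a variable
`π` with its defining equation `hπ`; boxes are order intervals `Set.Icc b.1 b.2` of `Site d` for a
pair of corners `b : Site d × Site d`; the WINDOW of a box is the set
`{e ∈ E(ℤ^d) | ∃ z ∈ Set.Icc b.1 b.2, z ∈ e}` of lattice edges meeting it; the cluster of the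
origin of a configuration `s ⊆ Sym2 (Site d)` is always computed from its genuine lattice edges,
`openCluster (s ∩ E(ℤ^d)) 0`):

* `mem_of_reachable_of_closed` — closure principle for reachability;
* `coord_sub_le_one_of_adj` — coordinates move by at most one along an edge of `ℤ^d`;
* `eq_of_proj_eq` — sites with equal projection and coordinate gaps `< n` coincide;
* `torusGraph_adj_proj`, `map_proj_mem_edgeSet` — `π_x` is a graph homomorphism for `n ≥ 2`;
* `injOn_map_proj_window` — `Sym2.map π_x` is injective on the window of a box with sides
  `b.2 i - b.1 i ≤ n - 2` (at most `n - 1` points), `n ≥ 3`;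
* `openCluster_eq_of_inter_window_eq`, `determinedBy_of_subset_box`,
  `measurableSet_of_determinedBy_window` — LOCALITY: an event `{s | P (cluster of 0)}` whose
  predicate forces the cluster into the box is determined by the edges of the window (and such
  events are measurable).

References: the coupling is the finite-range shadow of Benjamini–Schramm 1996 Thm 1 /
Heydenreich–van der Hofstad 2017 Prop. 13.7 (torus vs. `ℤ^d` clusters agree until the cluster
wraps); card
`Summits/CriticalPhenomena/PercolationContinuityZ3/Ideas/torus-slice-filling-identity-v2.md`.
Tree API used: `zdGraph_adj_iff`, `torusGraph_adj_iff`, `openGraph_adj`, `openCluster`,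
`DeterminedBy`, `determinedBy_iff`, `DeterminedBy.measurableSet_of_finset`.
-/

noncomputable section

namespace Summit.CriticalPhenomena.PercolationContinuityZ3.Theorems

namespace SliceFilling

open Literature.Probability.Percolation Literature.Probability.LatticeModels

variable {d n : ℕ}

/-! ### Closure principle for open clusters -/

/-- If a vertex set `S` is closed under the adjacency of `G`, it contains every vertex reachable
from one of its elements (induction along a walk). -/
theorem mem_of_reachable_of_closed {V : Type*} {G : SimpleGraph V} {S : Set V}
    (hS : ∀ u v, u ∈ S → G.Adj u v → v ∈ S) {u v : V} (h : G.Reachable u v) (hu : u ∈ S) :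
    v ∈ S := by
  obtain ⟨w⟩ := h
  induction w with
  | nil => exact hu
  | cons hadj _ ih => exact ih (hS _ _ hu hadj)

/-! ### Coordinates along lattice edges -/

/-- Along an edge of `ℤ^d` every coordinate changes by at most one. -/
theorem coord_sub_le_one_of_adj {u v : Site d} (h : (zdGraph d).Adj u v) (i : Fin d) :
    v i - u i ≤ 1 ∧ u i - v i ≤ 1 := by
  obtain ⟨j, hj | hj⟩ := (zdGraph_adj_iff u v).1 h
  · rw [hj]
    by_cases hij : i = j
    · subst hij; simp
    · simp [hij]
  · rw [hj]
    by_cases hij : i = j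
    · subst hij; simp
    · simp [hij]

/-! ### The covering projection with base point `x` -/

section Proj

variable (x : TorusSite d n) (π : Site d → TorusSite d n)

/-- `π 0 = x` for the projection `π z = x + (z mod n)`. -/
theorem proj_zero (hπ : ∀ z i, π z i = x i + ((z i : ℤ) : ZMod n)) : π 0 = x := by
  funext i; simp [hπ]

/-- `π (z + e_j) = π z + e_j`. -/
theorem proj_add_single (hπ : ∀ z i, π z i = x i + ((z i : ℤ) : ZMod n)) (z : Site d)
    (j : Fin d) : π (z + Pi.single j 1) = π z + Pi.single j 1 := by
  funext i
  by_cases hij : i = j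
  · subst hij; simp [hπ, add_assoc]
  · simp [hπ, hij]

/-- Two sites with the same projection whose coordinates differ by less than `n` coincide. -/
theorem eq_of_proj_eq (hπ : ∀ z i, π z i = x i + ((z i : ℤ) : ZMod n)) {z₁ z₂ : Site d}
    (h : π z₁ = π z₂) (hlt : ∀ i, |z₁ i - z₂ i| < n) : z₁ = z₂ := by
  funext i
  have hi : ((z₁ i : ℤ) : ZMod n) = ((z₂ i : ℤ) : ZMod n) := by
    have := congrFun h i
    simpa [hπ] using this
  rw [ZMod.intCast_eq_intCast_iff_dvd_sub] at hi
  have habs : |z₂ i - z₁ i| < n := by rw [abs_sub_comm]; exact hlt i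
  have h0 := Int.eq_zero_of_abs_lt_dvd hi habs
  omega

/-- The projection is a graph homomorphism `ℤ^d → (ℤ/nℤ)^d` as soon as `n ≥ 2`. -/
theorem torusGraph_adj_proj [Fact (1 < n)] (hπ : ∀ z i, π z i = x i + ((z i : ℤ) : ZMod n))
    {u v : Site d} (h : (zdGraph d).Adj u v) : (torusGraph d n).Adj (π u) (π v) := by
  rw [torusGraph_adj_iff]
  obtain ⟨j, hj | hj⟩ := (zdGraph_adj_iff u v).1 h
  · have hv : π v = π u + Pi.single j 1 := by rw [hj, proj_add_single x π hπ]
    refine ⟨?_, Or.inl ⟨j, hv⟩⟩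
    intro heq
    have := congrFun hv j
    rw [heq] at this
    simp at this
  · have hu : π u = π v + Pi.single j 1 := by rw [hj, proj_add_single x π hπ]
    refine ⟨?_, Or.inr ⟨j, hu⟩⟩
    intro heq
    have := congrFun hu j
    rw [heq] at this
    simp at this

/-- Edges of `ℤ^d` project to edges of the torus (`n ≥ 2`). -/
theorem map_proj_mem_edgeSet [Fact (1 < n)] (hπ : ∀ z i, π z i = x i + ((z i : ℤ) : ZMod n))
    {e : Sym2 (Site d)} (he : e ∈ (zdGraph d).edgeSet) :
    Sym2.map π e ∈ (torusGraph d n).edgeSet := by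
  induction e using Sym2.ind with
  | h u v =>
    rw [SimpleGraph.mem_edgeSet] at he
    rw [Sym2.map_mk, SimpleGraph.mem_edgeSet]
    exact torusGraph_adj_proj x π hπ he

end Proj

/-! ### Boxes `Set.Icc b.1 b.2` and their edge windows -/

/-- An edge from a box point belongs to the window of the box. -/
theorem mk_mem_window {b : Site d × Site d} {u v : Site d} (hu : u ∈ Set.Icc b.1 b.2)
    (h : (zdGraph d).Adj u v) :
    s(u, v) ∈ {e ∈ (zdGraph d).edgeSet | ∃ z ∈ Set.Icc b.1 b.2, z ∈ e} :=
  ⟨(SimpleGraph.mem_edgeSet _).2 h, u, hu, Sym2.mem_mk_left u v⟩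

/-- Edge windows of boxes are finite. -/
theorem window_finite (b : Site d × Site d) :
    {e ∈ (zdGraph d).edgeSet | ∃ z ∈ Set.Icc b.1 b.2, z ∈ e}.Finite := by
  have hfin : (⋃ z ∈ Set.Icc b.1 b.2, (zdGraph d).incidenceSet z).Finite :=
    (Set.finite_Icc b.1 b.2).biUnion fun z _ => ((zdGraph d).incidenceSet z).toFinite
  refine hfin.subset ?_
  rintro e ⟨he, z, hz, hze⟩
  exact Set.mem_biUnion hz ⟨he, hze⟩

/-- A neighbour of a box point lies in the box enlarged by one. -/
theorem mem_enlarged_of_adj {b : Site d × Site d} {u v : Site d} (hu : u ∈ Set.Icc b.1 b.2)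
    (h : (zdGraph d).Adj u v) (i : Fin d) : b.1 i - 1 ≤ v i ∧ v i ≤ b.2 i + 1 := by
  obtain ⟨h1, h2⟩ := coord_sub_le_one_of_adj h i
  have h3 : b.1 i ≤ u i := hu.1 i
  have h4 : u i ≤ b.2 i := hu.2 i
  constructor <;> omega

/-! ### The projection is injective on the window of a small box -/

/-- **Injectivity on windows.** If every side of the box has at most `n - 1` lattice points
(`b.2 i - b.1 i ≤ n - 2`) and `n ≥ 3`, then `Sym2.map π` is injective on the edge window of the
box: a box point and a point of the enlarged box with equal projections coincide, and two
neighbours of one point with equal projections coincide. -/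
theorem injOn_map_proj_window (hn : 3 ≤ n) (x : TorusSite d n) (π : Site d → TorusSite d n)
    (hπ : ∀ z i, π z i = x i + ((z i : ℤ) : ZMod n)) {b : Site d × Site d}
    (hb : ∀ i, b.2 i - b.1 i ≤ (n : ℤ) - 2) :
    Set.InjOn (Sym2.map π) {e ∈ (zdGraph d).edgeSet | ∃ z ∈ Set.Icc b.1 b.2, z ∈ e} := by
  have key : ∀ {w y : Site d}, w ∈ Set.Icc b.1 b.2 → (∀ i, b.1 i - 1 ≤ y i ∧ y i ≤ b.2 i + 1) →
      π w = π y → w = y := by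
    intro w y hw hy h
    refine eq_of_proj_eq x π hπ h fun i => ?_
    have h1 : b.1 i ≤ w i := hw.1 i
    have h2 : w i ≤ b.2 i := hw.2 i
    obtain ⟨h3, h4⟩ := hy i
    have := hb i
    rw [abs_lt]; constructor <;> omega
  have boxEnl : ∀ {w : Site d}, w ∈ Set.Icc b.1 b.2 → ∀ i, b.1 i - 1 ≤ w i ∧ w i ≤ b.2 i + 1 := by
    intro w hw i
    have h1 : b.1 i ≤ w i := hw.1 i
    have h2 : w i ≤ b.2 i := hw.2 i
    constructor <;> omega
  have key2 : ∀ {w y₁ y₂ : Site d}, (zdGraph d).Adj w y₁ → (zdGraph d).Adj w y₂ →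
      π y₁ = π y₂ → y₁ = y₂ := by
    intro w y₁ y₂ h₁ h₂ h
    refine eq_of_proj_eq x π hπ h fun i => ?_
    obtain ⟨a1, a2⟩ := coord_sub_le_one_of_adj h₁ i
    obtain ⟨c1, c2⟩ := coord_sub_le_one_of_adj h₂ i
    rw [abs_lt]; constructor <;> omega
  have main : ∀ {w₁ y₁ w₂ y₂ : Site d}, w₁ ∈ Set.Icc b.1 b.2 → w₂ ∈ Set.Icc b.1 b.2 →
      (zdGraph d).Adj w₁ y₁ → (zdGraph d).Adj w₂ y₂ →
      Sym2.map π s(w₁, y₁) = Sym2.map π s(w₂, y₂) → s(w₁, y₁) = s(w₂, y₂) := by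
    intro w₁ y₁ w₂ y₂ hw₁ hw₂ he₁ he₂ heq
    rw [Sym2.map_mk, Sym2.map_mk, Sym2.eq_iff] at heq
    rcases heq with ⟨h1, h2⟩ | ⟨h1, h2⟩
    · obtain rfl : w₁ = w₂ := key hw₁ (boxEnl hw₂) h1
      obtain rfl : y₁ = y₂ := key2 he₁ he₂ h2
      rfl
    · obtain rfl : w₁ = y₂ := key hw₁ (mem_enlarged_of_adj hw₂ he₂) h1
      obtain rfl : w₂ = y₁ := key hw₂ (mem_enlarged_of_adj hw₁ he₁) h2.symm
      exact Sym2.eq_swap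
  rintro e₁ ⟨he₁, w₁, hw₁, hwe₁⟩ e₂ ⟨he₂, w₂, hw₂, hwe₂⟩ heq
  rw [← Sym2.other_spec hwe₁] at he₁ heq ⊢
  rw [← Sym2.other_spec hwe₂] at he₂ heq ⊢
  rw [SimpleGraph.mem_edgeSet] at he₁ he₂
  exact main hw₁ hw₂ he₁ he₂ heq

/-- The window of any box is mapped into the edge set of the torus (`n ≥ 2`). -/
theorem mapsTo_map_proj_window [Fact (1 < n)] (x : TorusSite d n) (π : Site d → TorusSite d n)
    (hπ : ∀ z i, π z i = x i + ((z i : ℤ) : ZMod n)) (b : Site d × Site d) :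
    Set.MapsTo (Sym2.map π) {e ∈ (zdGraph d).edgeSet | ∃ z ∈ Set.Icc b.1 b.2, z ∈ e}
      (torusGraph d n).edgeSet :=
  fun _ he => map_proj_mem_edgeSet x π hπ he.1

/-! ### Locality of the cluster of the origin -/

/-- Adjacency in the open graph of the genuine lattice edges of `s`. -/
theorem adj_inter_edgeSet_iff {s : Set (Sym2 (Site d))} {u v : Site d} :
    (openGraph (s ∩ (zdGraph d).edgeSet)).Adj u v ↔ s(u, v) ∈ s ∧ (zdGraph d).Adj u v := by
  rw [openGraph_adj, Set.mem_inter_iff, SimpleGraph.mem_edgeSet]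
  constructor
  · rintro ⟨⟨h1, h2⟩, -⟩; exact ⟨h1, h2⟩
  · rintro ⟨h1, h2⟩; exact ⟨⟨h1, h2⟩, h2.ne⟩

/-- **Locality.** If the cluster of the origin in `s` stays inside the box `b`, then any
configuration agreeing with `s` on the window of `b` has the same cluster of the origin. -/
theorem openCluster_eq_of_inter_window_eq {b : Site d × Site d} {s s' : Set (Sym2 (Site d))}
    (hs : openCluster (s ∩ (zdGraph d).edgeSet) 0 ⊆ Set.Icc b.1 b.2)
    (h : s ∩ {e ∈ (zdGraph d).edgeSet | ∃ z ∈ Set.Icc b.1 b.2, z ∈ e} =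
      s' ∩ {e ∈ (zdGraph d).edgeSet | ∃ z ∈ Set.Icc b.1 b.2, z ∈ e}) :
    openCluster (s' ∩ (zdGraph d).edgeSet) 0 = openCluster (s ∩ (zdGraph d).edgeSet) 0 := by
  have hwin : ∀ e ∈ {e ∈ (zdGraph d).edgeSet | ∃ z ∈ Set.Icc b.1 b.2, z ∈ e}, e ∈ s ↔ e ∈ s' :=
    fun e he => by
    constructor
    · intro hes; exact ((Set.ext_iff.1 h e).1 ⟨hes, he⟩).1
    · intro hes; exact ((Set.ext_iff.1 h e).2 ⟨hes, he⟩).1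
  apply Set.Subset.antisymm
  · intro y hy
    refine mem_of_reachable_of_closed (G := openGraph (s' ∩ (zdGraph d).edgeSet))
      (S := openCluster (s ∩ (zdGraph d).edgeSet) 0) ?_ hy (mem_openCluster_self _ _)
    intro u v hu huv
    rw [adj_inter_edgeSet_iff] at huv
    have hes : s(u, v) ∈ s := (hwin _ (mk_mem_window (hs hu) huv.2)).2 huv.1
    exact SimpleGraph.Reachable.trans hu
      (SimpleGraph.Adj.reachable (adj_inter_edgeSet_iff.2 ⟨hes, huv.2⟩))
  · intro y hy
    suffices hy' : y ∈ openCluster (s ∩ (zdGraph d).edgeSet) 0 ∩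
        openCluster (s' ∩ (zdGraph d).edgeSet) 0 from hy'.2
    refine mem_of_reachable_of_closed (G := openGraph (s ∩ (zdGraph d).edgeSet))
      (S := openCluster (s ∩ (zdGraph d).edgeSet) 0 ∩ openCluster (s' ∩ (zdGraph d).edgeSet) 0)
      ?_ hy ⟨mem_openCluster_self _ _, mem_openCluster_self _ _⟩
    rintro u v ⟨hu, hu'⟩ huv
    rw [adj_inter_edgeSet_iff] at huv
    have hes' : s(u, v) ∈ s' := (hwin _ (mk_mem_window (hs hu) huv.2)).1 huv.1
    exact ⟨SimpleGraph.Reachable.trans hu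
        (SimpleGraph.Adj.reachable (adj_inter_edgeSet_iff.2 ⟨huv.1, huv.2⟩)),
      SimpleGraph.Reachable.trans hu'
        (SimpleGraph.Adj.reachable (adj_inter_edgeSet_iff.2 ⟨hes', huv.2⟩))⟩

/-- An event `{s | P (cluster of 0)}` whose predicate forces the cluster into the box `b` is
determined by the edges of the window of `b`. -/
theorem determinedBy_of_subset_box (b : Site d × Site d) {P : Set (Site d) → Prop}
    (hP : ∀ C, P C → C ⊆ Set.Icc b.1 b.2) :
    DeterminedBy {s : Set (Sym2 (Site d)) | P (openCluster (s ∩ (zdGraph d).edgeSet) 0)}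
      {e ∈ (zdGraph d).edgeSet | ∃ z ∈ Set.Icc b.1 b.2, z ∈ e} := by
  rw [determinedBy_iff]
  suffices h : ∀ s s' : Set (Sym2 (Site d)),
      s ∩ {e ∈ (zdGraph d).edgeSet | ∃ z ∈ Set.Icc b.1 b.2, z ∈ e} =
        s' ∩ {e ∈ (zdGraph d).edgeSet | ∃ z ∈ Set.Icc b.1 b.2, z ∈ e} →
      P (openCluster (s ∩ (zdGraph d).edgeSet) 0) →
        P (openCluster (s' ∩ (zdGraph d).edgeSet) 0) from
    fun s s' hss' => ⟨h s s' hss', h s' s hss'.symm⟩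
  intro s s' hss' hs
  rwa [openCluster_eq_of_inter_window_eq (hP _ hs) hss']

/-- An event determined by the window of a box is measurable (a cylinder event over a finite
set of coordinates). -/
theorem measurableSet_of_determinedBy_window (b : Site d × Site d) {A : Set (Set (Sym2 (Site d)))}
    (hA : DeterminedBy A {e ∈ (zdGraph d).edgeSet | ∃ z ∈ Set.Icc b.1 b.2, z ∈ e}) :
    MeasurableSet A := by
  have h : DeterminedBy A (↑(window_finite b).toFinset : Set (Sym2 (Site d))) := by
    rw [Set.Finite.coe_toFinset]
    exact hA
  exact h.measurableSet_of_finset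

end SliceFilling

end Summit.CriticalPhenomena.PercolationContinuityZ3.Theorems
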